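import Literature.NumberTheory.LFunctions.XiGaussWeight
import Literature.Probability.Distributions.BrascampLiebHalfLine
import Literature.Probability.Distributions.ConvexPotentialTails
import Mathlib.Analysis.Convex.Deriv
import HarnessLib

/-!
# The Gauss-tilted Pólya–de Bruijn weight `Φ(u) uⁿ e^{xu²/2}`: second moment about its mode

For the weight `ω_{n,x}(u) = Φ(u) uⁿ e^{xu²/2}` on `(0, ∞)` (`XiGaussWeight.lean`: the law against which
the Jensen polynomial `J^{d,n}_ξ(-x)` averages the Szegő normal form of `L_d^{(n-1/2)}`; potential
`W = xiPotential n - xu²/2` with `W″(u) > 16πe^{4u} + n/u² - x`; mode parametrisation `y = aL(a) - n`,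
`x = y/a²`, `W′(a) = 0`; envelope `16πe^{4a} ≥ 4(n+y)/a + 36`) this file derives the TWO-PIECE CURVATURE
FLOOR

  `W″ ≥ ρ := e^{-4τ}(4(n+y)/a + 36) - y/a²` on `[a-τ, ∞)`,  `W″ ≥ 16π` on `(0, a-τ)`
  (the latter when `y(a-τ)² ≤ na²`),

and Brascamp–Lieb on the half-line (tree, `integral_sq_sub_mul_exp_neg_le_of_curvature`), the left-tail
lemma (tree, `setIntegral_exp_neg_le_of_curvature_floor`) and a window lower bound for the normaliser
(curvature ceiling `Λ` from the tree's upper envelopes of `V` and lower envelope of `L`, `a ≥ 3/2`) give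

  `∫₀^∞ (u-a)² ω ≤ B · ∫₀^∞ ω`,  `B = 1/ρ + e^{1/2}√Λ e^{-ρτ²/2}/(16π ρ τ)`  (`xiGauss_sq_sub_integral_le`).

This is the variance input of the all-degree hyperbolicity threshold for the Jensen polynomials of
`ξ` (`JensenXiExponentialRange.lean`). No zero of `ζ` and no numerics beyond the tree's envelopes enter.

## References
* [BrascampLieb1976] Brascamp–Lieb, J. Funct. Anal. 22 (1976), Thm. 4.1 (`n = 1`).
* [CoffeyCsordas2013] Coffey–Csordas, Math. Comp. 82 (2013), Thm. 2.4, Prop. 2.1 (envelopes of `Φ′/Φ`).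
* [GORZPNAS2019] Griffin–Ono–Rolen–Zagier, PNAS 116 (2019), Thm. 7 (the tilted kernel `u^kΦ(u)`).
-/

noncomputable section

open MeasureTheory Set Real
open scoped Topology

namespace Literature.NumberTheory.LFunctions

open Literature.Probability.Distributions

variable (n : ℕ)

/-! ### The two-piece curvature floor -/

/-- `ρ(n, a, τ) := e^{-4τ}(4(n+y)/a + 36) - y/a²`, the bulk curvature floor. [cite: BrascampLieb1976, Thm 4.1 (n = 1)] -/
def xiGaussRho (a τ : ℝ) : ℝ :=
  Real.exp (-(4 * τ)) * (4 * (n + xiGaussY n a) / a + 36) - xiGaussY n a / a ^ 2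

/-- **Bulk floor**: `W″(u) > ρ` for `u ≥ a - τ`, `u > 0`. [cite: BrascampLieb1976, Thm 4.1 (n = 1)] -/
theorem xiGaussPotentialDeriv₂_gt_rho {a τ : ℝ} (ha : 0 < a) {u : ℝ} (hu : 0 < u) (hbu : a - τ ≤ u) :
    xiGaussRho n a τ < xiGaussPotentialDeriv₂ n (xiGaussX n a) u := by
  have h := xiGaussPotentialDeriv₂_gt n (xiGaussX n a) hu
  have hfl := xiGauss_floor_at_mode n ha
  have hexp : Real.exp (-(4 * τ)) * Real.exp (4 * a) ≤ Real.exp (4 * u) := by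
    rw [← Real.exp_add]; exact Real.exp_le_exp.2 (by linarith)
  have hn : (0 : ℝ) ≤ n / u ^ 2 := by positivity
  unfold xiGaussRho xiGaussX
  have key : Real.exp (-(4 * τ)) * (4 * (n + xiGaussY n a) / a + 36) ≤ 16 * π * Real.exp (4 * u) := by
    calc Real.exp (-(4 * τ)) * (4 * (n + xiGaussY n a) / a + 36)
        ≤ Real.exp (-(4 * τ)) * (16 * π * Real.exp (4 * a)) :=
          mul_le_mul_of_nonneg_left hfl (Real.exp_pos _).le
      _ = 16 * π * (Real.exp (-(4 * τ)) * Real.exp (4 * a)) := by ring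
      _ ≤ 16 * π * Real.exp (4 * u) := mul_le_mul_of_nonneg_left hexp (by positivity)
  unfold xiGaussX at h
  linarith

/-- **Left floor**: if `y(a-τ)² ≤ na²` then `W″(u) > 16π` for `0 < u < a - τ`.
[cite: BrascampLieb1976, Thm 4.1 (n = 1)] -/
theorem xiGaussPotentialDeriv₂_gt_sixteen_pi {a τ : ℝ} (ha : 0 < a)
    (hC : xiGaussY n a * (a - τ) ^ 2 ≤ n * a ^ 2) {u : ℝ} (hu : 0 < u) (hub : u < a - τ) :
    16 * π < xiGaussPotentialDeriv₂ n (xiGaussX n a) u := by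
  have h := xiGaussPotentialDeriv₂_gt n (xiGaussX n a) hu
  have h1 : (1 : ℝ) ≤ Real.exp (4 * u) := Real.one_le_exp (by linarith)
  have h2 : 16 * π ≤ 16 * π * Real.exp (4 * u) := by nlinarith [Real.pi_pos]
  -- `x ≤ n/u²` from `x (a-τ)² ≤ n` and `u < a - τ`
  have h3 : xiGaussX n a ≤ n / u ^ 2 := by
    unfold xiGaussX
    rw [div_le_div_iff₀ (pow_pos ha 2) (pow_pos hu 2)]
    have hu2 : u ^ 2 ≤ (a - τ) ^ 2 := pow_le_pow_left₀ hu.le hub.le 2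
    rcases le_or_gt 0 (xiGaussY n a) with hy | hy
    · calc xiGaussY n a * u ^ 2 ≤ xiGaussY n a * (a - τ) ^ 2 := mul_le_mul_of_nonneg_left hu2 hy
        _ ≤ n * a ^ 2 := hC
    · have : xiGaussY n a * u ^ 2 ≤ 0 := mul_nonpos_of_nonpos_of_nonneg hy.le (sq_nonneg u)
      have : (0 : ℝ) ≤ n * a ^ 2 := by positivity
      linarith
  linarith

/-! ### Convexity and the normaliser -/

/-- If `W″ > 0` on `(0, ∞)` then `W` is convex there. [cite: CoffeyCsordas2013, Theorem 2.4] -/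
theorem convexOn_xiGaussPotential (x : ℝ) (hpos : ∀ u, 0 < u → 0 < xiGaussPotentialDeriv₂ n x u) :
    ConvexOn ℝ (Ioi 0) (xiGaussPotential n x) := by
  have hder : ∀ u ∈ Ioi (0 : ℝ), HasDerivAt (xiGaussPotential n x) (xiGaussPotentialDeriv n x u) u :=
    fun u hu => hasDerivAt_xiGaussPotential n x (ne_of_gt hu)
  refine MonotoneOn.convexOn_of_deriv (convex_Ioi 0)
    (fun u hu => (hder u hu).continuousAt.continuousWithinAt)
    (fun u hu => (hder u (interior_subset hu)).differentiableAt.differentiableWithinAt) ?_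
  rw [interior_Ioi]
  have hmono : MonotoneOn (xiGaussPotentialDeriv n x) (Ioi 0) := by
    refine monotoneOn_of_hasDerivWithinAt_nonneg (convex_Ioi 0) (f' := xiGaussPotentialDeriv₂ n x)
      (fun u hu => (hasDerivAt_xiGaussPotentialDeriv n x (ne_of_gt hu)).continuousAt.continuousWithinAt)
      (fun u hu => ?_) (fun u hu => ?_)
    · rw [interior_Ioi] at hu
      exact (hasDerivAt_xiGaussPotentialDeriv n x (ne_of_gt hu)).hasDerivWithinAt
    · rw [interior_Ioi] at hu
      exact (hpos u hu).le
  exact hmono.congr fun u hu => ((hder u hu).deriv).symm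

/-- `Λ(n, a) := e(1 + 10⁻⁶)(4(n+y)/a + 36.02) + n/a²`, a curvature ceiling on `[a, a + 1/4]`.
[cite: CoffeyCsordas2013, Theorem 2.4 (proof) and (2.8)] -/
def xiGaussLam (a : ℝ) : ℝ :=
  Real.exp 1 * (1 + 1 / 10 ^ 6) * (4 * (n + xiGaussY n a) / a + 9005 / 250) + n / a ^ 2

/-- **Curvature ceiling near the mode** (`a ≥ 3/2`, `y ≥ 0`): `W″(u) ≤ Λ` for `u ∈ [a, a + 1/4]`.
[cite: CoffeyCsordas2013, Theorem 2.4 (proof) and (2.8)] -/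
theorem xiGaussPotentialDeriv₂_le_lam {a : ℝ} (ha : 3 / 2 ≤ a) (hy : 0 ≤ xiGaussY n a) {u : ℝ}
    (hu : u ∈ Icc a (a + 1 / 4)) : xiGaussPotentialDeriv₂ n (xiGaussX n a) u ≤ xiGaussLam n a := by
  have ha0 : 0 < a := lt_of_lt_of_le (by norm_num) ha
  have hu0 : 0 < u := lt_of_lt_of_le ha0 hu.1
  have hu32 : 3 / 2 ≤ u := ha.trans hu.1
  have hV : phiNegLogDeriv₂ u ≤ 16 * π * Real.exp (4 * u) * (1 + 1 / 10 ^ 6) := by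
    unfold phiNegLogDeriv₂; exact deBruijnPhi_logConcave_upper_div hu32
  have hceil := xiGauss_ceiling_at_mode n ha
  have hx0 : 0 ≤ xiGaussX n a := div_nonneg hy (pow_pos ha0 2).le
  -- `n/u² ≤ n/a²`
  have h1 : (n : ℝ) / u ^ 2 ≤ n / a ^ 2 :=
    div_le_div_of_nonneg_left (Nat.cast_nonneg n) (pow_pos ha0 2) (pow_le_pow_left₀ ha0.le hu.1 2)
  -- `e^{4u} ≤ e · e^{4a}`
  have h2 : Real.exp (4 * u) ≤ Real.exp 1 * Real.exp (4 * a) := by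
    rw [← Real.exp_add]; exact Real.exp_le_exp.2 (by linarith [hu.2])
  have h3 : 16 * π * Real.exp (4 * u) * (1 + 1 / 10 ^ 6) ≤
      Real.exp 1 * (1 + 1 / 10 ^ 6) * (4 * (n + xiGaussY n a) / a + 9005 / 250) := by
    calc 16 * π * Real.exp (4 * u) * (1 + 1 / 10 ^ 6)
        ≤ 16 * π * (Real.exp 1 * Real.exp (4 * a)) * (1 + 1 / 10 ^ 6) := by gcongr
      _ = Real.exp 1 * (1 + 1 / 10 ^ 6) * (16 * π * Real.exp (4 * a)) := by ring
      _ ≤ _ := by gcongr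
  unfold xiGaussPotentialDeriv₂ xiPotentialDeriv₂ xiGaussLam
  linarith

/-- **Window lower bound for the normaliser** (`a ≥ 3/2`, `y ≥ 0`):
`e^{-W(a)} ≤ e^{1/2} √Λ · ∫₀^∞ ω_{n,x}` (integrate `e^{-W} ≥ e^{-W(a) - Λσ²/2}` over `[a, a + σ]`,
`σ = Λ^{-1/2} ≤ 1/4`). [cite: Peypouquet2015, Lemma 1.30] -/
theorem exp_neg_potential_mode_le {a : ℝ} (ha : 3 / 2 ≤ a) (hy : 0 ≤ xiGaussY n a) :
    Real.exp (-xiGaussPotential n (xiGaussX n a) a) ≤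
      Real.exp (1 / 2) * Real.sqrt (xiGaussLam n a) * ∫ u in Ioi 0, xiGaussWeight n (xiGaussX n a) u := by
  have ha0 : 0 < a := lt_of_lt_of_le (by norm_num) ha
  set x := xiGaussX n a with hx
  set Λ := xiGaussLam n a with hΛ
  -- `Λ ≥ 16`
  have hΛ16 : 16 ≤ Λ := by
    have he : (2.5 : ℝ) ≤ Real.exp 1 := by
      have := Real.add_one_le_exp (1 : ℝ); have h2 := Real.exp_one_gt_d9; linarith
    have hya : 0 ≤ 4 * (n + xiGaussY n a) / a := by positivity
    have hna : (0 : ℝ) ≤ n / a ^ 2 := by positivity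
    rw [hΛ, xiGaussLam]
    nlinarith
  have hΛpos : 0 < Λ := by linarith
  set σ := 1 / Real.sqrt Λ with hσ
  have hsqrt : 0 < Real.sqrt Λ := Real.sqrt_pos.2 hΛpos
  have hσpos : 0 < σ := by rw [hσ]; positivity
  have hσle : σ ≤ 1 / 4 := by
    rw [hσ, div_le_div_iff_of_pos_left one_pos hsqrt (by norm_num : (0:ℝ) < 4)]
    have : Real.sqrt 16 ≤ Real.sqrt Λ := Real.sqrt_le_sqrt hΛ16
    have h16 : Real.sqrt 16 = 4 := by
      rw [show (16 : ℝ) = 4 ^ 2 by norm_num, Real.sqrt_sq (by norm_num)]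
    linarith
  have hΛσ : Λ * σ ^ 2 = 1 := by
    rw [hσ, div_pow, one_pow, Real.sq_sqrt hΛpos.le]; field_simp
  -- descent lemma on `[a, a + σ]`
  have hsub : ∀ u ∈ Icc a (a + σ), xiGaussPotential n x u - xiGaussPotential n x a ≤ Λ * (u - a) ^ 2 / 2 := by
    intro u hu
    refine sub_le_mul_sq_div_two_of_deriv2_le (g := xiGaussPotential n x)
      (g₁ := xiGaussPotentialDeriv n x) (g₂ := xiGaussPotentialDeriv₂ n x)
      (left_mem_Icc.2 (by linarith)) (fun v hv => hasDerivAt_xiGaussPotential n x ?_)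
      (fun v hv => hasDerivAt_xiGaussPotentialDeriv n x ?_) (fun v hv => ?_)
      (xiGaussPotentialDeriv_mode n ha0) hu
    · exact (lt_of_lt_of_le ha0 hv.1).ne'
    · exact (lt_of_lt_of_le ha0 hv.1).ne'
    · exact xiGaussPotentialDeriv₂_le_lam n ha hy ⟨hv.1, hv.2.trans (by linarith)⟩
  -- pointwise lower bound of the weight on the window
  have hpt : ∀ u ∈ Icc a (a + σ), Real.exp (-xiGaussPotential n x a) * Real.exp (-(1 / 2)) ≤
      xiGaussWeight n x u := by
    intro u hu
    have hu0 : 0 < u := lt_of_lt_of_le ha0 hu.1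
    rw [← exp_neg_xiGaussPotential n x hu0, ← Real.exp_add]
    refine Real.exp_le_exp.2 ?_
    have h := hsub u hu
    have hua : (u - a) ^ 2 ≤ σ ^ 2 := by
      have : 0 ≤ u - a := by linarith [hu.1]
      exact pow_le_pow_left₀ this (by linarith [hu.2]) 2
    have : Λ * (u - a) ^ 2 / 2 ≤ 1 / 2 := by
      have := mul_le_mul_of_nonneg_left hua hΛpos.le
      rw [hΛσ] at this; linarith
    linarith
  -- integrate over the window and compare with the whole half-line
  have hwin : σ * (Real.exp (-xiGaussPotential n x a) * Real.exp (-(1 / 2))) ≤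
      ∫ u in Icc a (a + σ), xiGaussWeight n x u := by
    have hconst : ∫ _ in Icc a (a + σ), Real.exp (-xiGaussPotential n x a) * Real.exp (-(1 / 2)) =
        σ * (Real.exp (-xiGaussPotential n x a) * Real.exp (-(1 / 2))) := by
      rw [setIntegral_const, Real.volume_real_Icc_of_le (by linarith), smul_eq_mul]
      ring
    rw [← hconst]
    refine setIntegral_mono_on continuousOn_const.integrableOn_Icc
      ((integrableOn_xiGaussWeight n x).mono_set (fun u hu => lt_of_lt_of_le ha0 hu.1))
      measurableSet_Icc hpt
  have hmono : ∫ u in Icc a (a + σ), xiGaussWeight n x u ≤ ∫ u in Ioi 0, xiGaussWeight n x u :=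
    setIntegral_mono_set (integrableOn_xiGaussWeight n x)
      (ae_restrict_of_forall_mem measurableSet_Ioi fun u hu => (xiGaussWeight_pos n x hu).le)
      (Filter.Eventually.of_forall fun u hu => lt_of_lt_of_le ha0 hu.1 : (Icc a (a + σ) : Set ℝ) ≤ᵐ[volume] Ioi 0)
  -- rearrange: `e^{-W a} ≤ e^{1/2} √Λ ∫ ω`, using `σ √Λ = 1` and `e^{1/2} e^{-1/2} = 1`
  have hZ := le_trans hwin hmono
  have e1 : Real.exp (1 / 2) * Real.exp (-(1 / 2)) = 1 := by rw [← Real.exp_add]; norm_num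
  have e2 : σ * Real.sqrt Λ = 1 := by rw [hσ]; field_simp
  calc Real.exp (-xiGaussPotential n x a)
      = (Real.exp (1 / 2) * Real.sqrt Λ) * (σ * (Real.exp (-xiGaussPotential n x a) * Real.exp (-(1 / 2)))) := by
        calc Real.exp (-xiGaussPotential n x a)
            = (Real.exp (1 / 2) * Real.exp (-(1 / 2))) * (σ * Real.sqrt Λ) *
                Real.exp (-xiGaussPotential n x a) := by rw [e1, e2]; ring
          _ = _ := by ring
    _ ≤ (Real.exp (1 / 2) * Real.sqrt Λ) * ∫ u in Ioi 0, xiGaussWeight n x u :=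
        mul_le_mul_of_nonneg_left hZ (by positivity)

/-! ### The second moment about the mode -/

/-- `B(n, a, τ) := 1/ρ + e^{1/2} √Λ e^{-ρτ²/2}/(16π ρ τ)`: the bound for the normalised second moment of
`ω_{n,x(a)}` about its mode `a`. [cite: BrascampLieb1976, Thm 4.1 (n = 1)] -/
def xiGaussB (a τ : ℝ) : ℝ :=
  1 / xiGaussRho n a τ + Real.exp (1 / 2) * Real.sqrt (xiGaussLam n a) *
    Real.exp (-(xiGaussRho n a τ * τ ^ 2 / 2)) / (16 * π * xiGaussRho n a τ * τ)

/-- **Second moment of the Gauss-tilted weight about its mode.** Let `a ≥ 3/2`, `0 < τ ≤ 1/4`,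
`y = aL(a) - n ≥ 0`, `x = y/a²` (so `a` is the mode of `ω_{n,x} = Φ(u)uⁿe^{xu²/2}`), and assume the
left-floor condition `y(a - τ)² ≤ na²` and `ρ > 0`. Then
`∫₀^∞ (u - a)² ω_{n,x} ≤ B · ∫₀^∞ ω_{n,x}` with `B = 1/ρ + e^{1/2}√Λ e^{-ρτ²/2}/(16πρτ)`
(Brascamp–Lieb with the two-piece floor, the left-tail lemma below `a - τ`, and the window bound for the
normaliser). [cite: BrascampLieb1976, Thm 4.1 (n = 1)] -/
theorem xiGauss_sq_sub_integral_le {a τ : ℝ} (ha : 3 / 2 ≤ a) (hτ : 0 < τ) (hτ4 : τ ≤ 1 / 4)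
    (hy : 0 ≤ xiGaussY n a) (hC : xiGaussY n a * (a - τ) ^ 2 ≤ n * a ^ 2)
    (hρ : 0 < xiGaussRho n a τ) :
    ∫ u in Ioi 0, (u - a) ^ 2 * xiGaussWeight n (xiGaussX n a) u ≤
      xiGaussB n a τ * ∫ u in Ioi 0, xiGaussWeight n (xiGaussX n a) u := by
  have ha0 : 0 < a := lt_of_lt_of_le (by norm_num) ha
  have hb : 0 < a - τ := by linarith
  set x := xiGaussX n a with hx
  set ρ := xiGaussRho n a τ with hρdef
  set g := xiGaussPotential n x with hg
  set g₁ := xiGaussPotentialDeriv n x with hg₁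
  set g₂ := xiGaussPotentialDeriv₂ n x with hg₂
  set Z := ∫ u in Ioi 0, xiGaussWeight n x u with hZ
  have hgd : ∀ u ∈ Ioi (0 : ℝ), HasDerivAt g (g₁ u) u := fun u hu =>
    hasDerivAt_xiGaussPotential n x (ne_of_gt hu)
  have hg₁d : ∀ u ∈ Ioi (0 : ℝ), HasDerivAt g₁ (g₂ u) u := fun u hu =>
    hasDerivAt_xiGaussPotentialDeriv n x (ne_of_gt hu)
  have hg₂c : ContinuousOn g₂ (Ioi 0) := continuousOn_xiGaussPotentialDeriv₂ n x
  have hfloor : ∀ u ∈ Ioi (0 : ℝ), a - τ ≤ u → ρ ≤ g₂ u := fun u hu hbu =>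
    (xiGaussPotentialDeriv₂_gt_rho n ha0 hu hbu).le
  have hfloor' : ∀ u ∈ Ioi (0 : ℝ), u < a - τ → 16 * π ≤ g₂ u := fun u hu hub =>
    (xiGaussPotentialDeriv₂_gt_sixteen_pi n ha0 hC hu hub).le
  have hpos : ∀ u ∈ Ioi (0 : ℝ), 0 < g₂ u := by
    intro u hu
    rcases lt_or_ge u (a - τ) with h | h
    · exact lt_of_lt_of_le (by positivity) (hfloor' u hu h)
    · exact hρ.trans_le (hfloor u hu h)
  have hga : g₁ a = 0 := xiGaussPotentialDeriv_mode n ha0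
  have hexp : EqOn (fun u => Real.exp (-g u)) (xiGaussWeight n x) (Ioi 0) :=
    fun u hu => exp_neg_xiGaussPotential n x hu
  have hint : IntegrableOn (fun u => Real.exp (-g u)) (Ioi 0) :=
    (integrableOn_xiGaussWeight n x).congr_fun hexp.symm measurableSet_Ioi
  -- Brascamp–Lieb with the two-piece floor
  obtain ⟨-, hBL⟩ := integral_sq_sub_mul_exp_neg_le_of_curvature ha0 hgd hg₁d hg₂c hpos hga hρ
    (by positivity : (0 : ℝ) < 16 * π) hfloor hfloor' hint
  -- the left tail
  have hconv : ConvexOn ℝ (Ioi 0) g := convexOn_xiGaussPotential n x fun u hu => hpos u hu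
  have htail : ∫ u in Ioi 0 ∩ Iio (a - τ), Real.exp (-g u) ≤
      Real.exp (-g a) * Real.exp (-(ρ * (a - (a - τ)) ^ 2 / 2)) / (ρ * (a - (a - τ))) := by
    refine setIntegral_exp_neg_le_of_curvature_floor (by linarith : a - τ < a) hρ hconv
      (fun u hu => lt_of_lt_of_le hb hu.1) (fun u hu => hgd u (lt_of_lt_of_le hb hu.1))
      (fun u hu => hg₁d u (lt_of_lt_of_le hb hu.1)) (fun u hu => hfloor u (lt_of_lt_of_le hb hu.1) hu.1)
      hga (fun u hu => ⟨hu.1, hu.2⟩) (measurableSet_Ioi.inter measurableSet_Iio)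
  rw [show a - (a - τ) = τ by ring] at htail
  -- the normaliser from below
  have hnorm := exp_neg_potential_mode_le n ha hy
  rw [← hx] at hnorm
  -- convert the `e^{-g}` integrals into `ω` integrals
  have e0 : ∫ u in Ioi 0, (u - a) ^ 2 * Real.exp (-g u) = ∫ u in Ioi 0, (u - a) ^ 2 * xiGaussWeight n x u :=
    setIntegral_congr_fun measurableSet_Ioi fun u hu => by simp only [hexp hu]
  have e1 : ∫ u in Ioi 0 ∩ Ici (a - τ), Real.exp (-g u) ≤ Z := by
    rw [setIntegral_congr_fun (measurableSet_Ioi.inter measurableSet_Ici) fun u hu => hexp hu.1]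
    exact setIntegral_mono_set (integrableOn_xiGaussWeight n x)
      (ae_restrict_of_forall_mem measurableSet_Ioi fun u hu => (xiGaussWeight_pos n x hu).le)
      inter_subset_left.eventuallyLE
  rw [e0] at hBL
  -- assemble
  have hρτ : 0 < ρ * τ := mul_pos hρ hτ
  have hZpos : 0 < Z := integral_xiGaussWeight_pos n x
  have htail' : ∫ u in Ioi 0 ∩ Iio (a - τ), Real.exp (-g u) ≤
      (Real.exp (1 / 2) * Real.sqrt (xiGaussLam n a) * Z) * Real.exp (-(ρ * τ ^ 2 / 2)) / (ρ * τ) := by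
    refine htail.trans ?_
    gcongr
  have hB : xiGaussB n a τ * Z = ρ⁻¹ * Z + (16 * π)⁻¹ *
      ((Real.exp (1 / 2) * Real.sqrt (xiGaussLam n a) * Z) * Real.exp (-(ρ * τ ^ 2 / 2)) / (ρ * τ)) := by
    rw [xiGaussB, ← hρdef]
    field_simp
  rw [hB]
  refine hBL.trans ?_
  gcongr

end Literature.NumberTheory.LFunctions
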